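import Mathlib
import HarnessLib
import Literature.Analysis.PDE.DivFormLiouville
import Summits.NavierStokesRegularity.NavierStokesRegularity.Theorems.PoloidalWindowDoorPoloidalWindowRigidityDivFormCaccioppoli
import Summits.NavierStokesRegularity.NavierStokesRegularity.Theorems.PoloidalWindowDoorPoloidalWindowRigidityDivFormReduction

/-!
# Route `PoloidalWindowDoor`, crux K2 (stmt-NavierStokesRegularity-19708) — task H5: DIMENSION LIFTING for divergence-form
# equations and the reduction `(unit-ball Harnack, n ≥ 3) ⇒ Literature.Analysis.PDE.divFormLiouville`

Sequel of `…DivFormReduction` (covariance; Harnack ⇒ Liouville).  Setting = the rendering of the named fact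
`divFormLiouville` (Jost, *PDE*, Thm 14.2.3; Moser 1961).

* `liouville_lift` — **dimension lifting**: the Liouville property (bounded entire `C¹` weak solutions are constant) in
  dimension `n + 1` implies it in dimension `n`: a solution `u` for the coefficients `a` on `ℝⁿ` lifts to `U = u ∘ π` on
  `ℝⁿ⁺¹` with the block coefficients `a ⊕ 1` (constants `min λ 1`, `max Λ 1`), again a bounded entire `C¹` weak solution —
  the `(n+1)`-dimensional weak formulation reduces by Fubini over the extra coordinate to the `n`-dimensional one tested
  against the slices `η(·, t)`.  This replaces the separate capacity (`n = 2`) and ODE (`n = 1`) arguments for the low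
  dimensions, where the Sobolev inequality with `p = 2` is not available.
* `divFormLiouville_of_unitHarnack_three_le` — **the assembly**: Moser's Harnack inequality on `B(0,1)` for entire
  positive `C¹` weak solutions in dimensions `n ≥ 3`, with a constant depending only on `(n, λ, Λ)`, implies the named
  fact `divFormLiouville` in EVERY dimension (`n ≥ 3`: `liouville_of_unitHarnack`; `n ≤ 2`: descend with
  `liouville_lift`).

Housed under the route's Theorems as a HELPER of the crux (consumer: the K2 lead's conditional elliptic-slope stratum
`…EllipticSlope.eq_zero_of_ellipticShear`, p482138); seat nsreg-p6 g7, no claim (the fact's claim #1 is K2-p3's, whose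
milestones M2/M3 supply the Harnack inequality).

WHAT THIS IS NOT: not the Liouville theorem and not the Harnack inequality — the reduction of the former to the latter;
nothing here is specific to Navier–Stokes.
-/

noncomputable section

open MeasureTheory Set Function Filter Topology Metric
open scoped Matrix

-- the summit and its single sub-problem share the name (CONVENTIONS §1), as in every Theorems file
set_option linter.dupNamespace false

namespace Summit.NavierStokesRegularity.NavierStokesRegularity.Theorems.PoloidalWindowDoorPoloidalWindowRigidityDivFormLift

open Summit.NavierStokesRegularity.NavierStokesRegularity.Theorems.PoloidalWindowDoorPoloidalWindowRigidityDivFormCaccioppoli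
open Summit.NavierStokesRegularity.NavierStokesRegularity.Theorems.PoloidalWindowDoorPoloidalWindowRigidityDivFormReduction

variable {n : ℕ}
variable {a : EuclideanSpace ℝ (Fin n) → Matrix (Fin n) (Fin n) ℝ} {u : EuclideanSpace ℝ (Fin n) → ℝ}

/-! ### Dimension lifting: Liouville in dimension `n + 1` implies Liouville in dimension `n` -/

/-- **Dimension lifting.**  If every bounded entire `C¹` weak solution of every admissible divergence-form equation
on `ℝⁿ⁺¹` is constant, then the same holds on `ℝⁿ`: a solution `u` for the coefficients `a` on `ℝⁿ` lifts to
`U(z) = u(z₀,…,z_{n−1})` on `ℝⁿ⁺¹`, an entire bounded `C¹` weak solution for the block coefficients `a ⊕ 1`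
(measurable, symmetric, constants `min λ 1`, `max Λ 1`) — the weak formulation in `n + 1` variables reduces, by
Fubini over the last coordinate, to the `n`-dimensional one tested against the slices `η(·, t) ∈ C¹_c(ℝⁿ)`. -/
theorem liouville_lift
    (H : ∀ (A : EuclideanSpace ℝ (Fin (n + 1)) → Matrix (Fin (n + 1)) (Fin (n + 1)) ℝ) (lam Λ : ℝ), 0 < lam →
      (∀ i j, Measurable fun y => A y i j) → (∀ y, (A y).IsSymm) →
      (∀ y (ξ : Fin (n + 1) → ℝ), lam * (ξ ⬝ᵥ ξ) ≤ ξ ⬝ᵥ (A y *ᵥ ξ)) → (∀ y i j, |A y i j| ≤ Λ) →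
      ∀ (U : EuclideanSpace ℝ (Fin (n + 1)) → ℝ), ContDiff ℝ 1 U → (∃ K : ℝ, ∀ y, |U y| ≤ K) →
        (∀ η : EuclideanSpace ℝ (Fin (n + 1)) → ℝ, ContDiff ℝ 1 η → HasCompactSupport η →
          ∫ y, ∑ i, ∑ j, A y i j * fderiv ℝ U y (EuclideanSpace.single i 1) *
            fderiv ℝ η y (EuclideanSpace.single j 1) = 0) →
        ∀ x y, U x = U y)
    {lam Λ : ℝ} (hlam : 0 < lam) (hmeas : ∀ i j, Measurable fun y => a y i j) (hsymm : ∀ y, (a y).IsSymm)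
    (hell : ∀ y (ξ : Fin n → ℝ), lam * (ξ ⬝ᵥ ξ) ≤ ξ ⬝ᵥ (a y *ᵥ ξ)) (hbd : ∀ y i j, |a y i j| ≤ Λ)
    (hu : ContDiff ℝ 1 u) (hbdd : ∃ K : ℝ, ∀ y, |u y| ≤ K)
    (hweak : ∀ η : EuclideanSpace ℝ (Fin n) → ℝ, ContDiff ℝ 1 η → HasCompactSupport η →
      ∫ y, ∑ i, ∑ j, a y i j * fderiv ℝ u y (EuclideanSpace.single i 1) *
        fderiv ℝ η y (EuclideanSpace.single j 1) = 0) :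
    ∀ x y, u x = u y := by
  classical
  /- the projection `π` (drop the last coordinate), the embedding `ι` (append a zero) and the affine slices
  `emb t x = ι x + t e_last` -/
  let πₗ : EuclideanSpace ℝ (Fin (n + 1)) →ₗ[ℝ] EuclideanSpace ℝ (Fin n) :=
    { toFun := fun z => WithLp.toLp 2 fun i : Fin n => z (Fin.castSucc i)
      map_add' := fun z z' => by ext i; simp
      map_smul' := fun c z => by ext i; simp }
  let π : EuclideanSpace ℝ (Fin (n + 1)) →L[ℝ] EuclideanSpace ℝ (Fin n) := LinearMap.toContinuousLinearMap πₗ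
  have hπ_apply : ∀ (z : EuclideanSpace ℝ (Fin (n + 1))) (i : Fin n), π z i = z (Fin.castSucc i) :=
    fun z i => rfl
  let ιₗ : EuclideanSpace ℝ (Fin n) →ₗ[ℝ] EuclideanSpace ℝ (Fin (n + 1)) :=
    { toFun := fun x => WithLp.toLp 2 (Fin.snoc (α := fun _ => ℝ) (WithLp.ofLp x) 0)
      map_add' := fun x x' => by
        ext i
        induction i using Fin.lastCases with
        | last => simp
        | cast i => simp
      map_smul' := fun c x => by
        ext i
        induction i using Fin.lastCases with
        | last => simp
        | cast i => simp }
  let ι : EuclideanSpace ℝ (Fin n) →L[ℝ] EuclideanSpace ℝ (Fin (n + 1)) := LinearMap.toContinuousLinearMap ιₗ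
  have hι_cast : ∀ (x : EuclideanSpace ℝ (Fin n)) (i : Fin n), ι x (Fin.castSucc i) = x i := fun x i => by
    show (WithLp.toLp 2 (Fin.snoc (α := fun _ => ℝ) (WithLp.ofLp x) 0) : EuclideanSpace ℝ (Fin (n + 1)))
      (Fin.castSucc i) = x i
    simp
  have hι_last : ∀ (x : EuclideanSpace ℝ (Fin n)), ι x (Fin.last n) = 0 := fun x => by
    show (WithLp.toLp 2 (Fin.snoc (α := fun _ => ℝ) (WithLp.ofLp x) 0) : EuclideanSpace ℝ (Fin (n + 1)))
      (Fin.last n) = 0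
    simp
  let eL : EuclideanSpace ℝ (Fin (n + 1)) := EuclideanSpace.single (Fin.last n) 1
  let emb : ℝ → EuclideanSpace ℝ (Fin n) → EuclideanSpace ℝ (Fin (n + 1)) := fun t x => ι x + t • eL
  have hemb_cast : ∀ t x (i : Fin n), emb t x (Fin.castSucc i) = x i := fun t x i => by
    simp [emb, eL, hι_cast, (Fin.castSucc_lt_last i).ne]
  have hemb_last : ∀ t x, emb t x (Fin.last n) = t := fun t x => by
    simp [emb, eL, hι_last]
  have hπ_emb : ∀ t x, π (emb t x) = x := fun t x => by
    ext i; rw [hπ_apply, hemb_cast]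
  have hπ_single : ∀ i : Fin n, π (EuclideanSpace.single (Fin.castSucc i) 1) = EuclideanSpace.single i 1 :=
    fun i => by ext j; simp [hπ_apply, Fin.castSucc_inj]
  have hπ_eL : π (EuclideanSpace.single (Fin.last n) 1) = 0 := by
    ext j; simp [hπ_apply, (Fin.castSucc_lt_last j).ne]
  have hι_single : ∀ j : Fin n, ι (EuclideanSpace.single j 1) = EuclideanSpace.single (Fin.castSucc j) 1 := by
    intro j; ext i
    induction i using Fin.lastCases with
    | last => simp [hι_last, (Fin.castSucc_lt_last j).ne']
    | cast i => simp [hι_cast, Fin.castSucc_inj]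
  /- the lifted coefficients `A = a ⊕ 1` and solution `U = u ∘ π` -/
  let A : EuclideanSpace ℝ (Fin (n + 1)) → Matrix (Fin (n + 1)) (Fin (n + 1)) ℝ := fun z =>
    Matrix.of fun i j => Fin.snoc (α := fun _ => ℝ)
      (fun i' : Fin n => Fin.snoc (α := fun _ => ℝ) (fun j' : Fin n => a (π z) i' j') (0 : ℝ) j)
      (Fin.snoc (α := fun _ => ℝ) (fun _ : Fin n => (0 : ℝ)) (1 : ℝ) j) i
  have hA_cc : ∀ z (i j : Fin n), A z (Fin.castSucc i) (Fin.castSucc j) = a (π z) i j := fun z i j => by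
    simp [A]
  have hA_cl : ∀ z (i : Fin n), A z (Fin.castSucc i) (Fin.last n) = 0 := fun z i => by simp [A]
  have hA_lc : ∀ z (j : Fin n), A z (Fin.last n) (Fin.castSucc j) = 0 := fun z j => by simp [A]
  have hA_ll : ∀ z, A z (Fin.last n) (Fin.last n) = 1 := fun z => by simp [A]
  let U : EuclideanSpace ℝ (Fin (n + 1)) → ℝ := fun z => u (π z)
  have hU : ContDiff ℝ 1 U := hu.comp π.contDiff
  have hdU : ∀ z w, fderiv ℝ U z w = fderiv ℝ u (π z) (π w) := by
    intro z w
    have h := ((hu.differentiable one_ne_zero) (π z)).hasFDerivAt.comp z π.hasFDerivAt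
    rw [show U = u ∘ π from rfl, h.fderiv, ContinuousLinearMap.comp_apply]
  -- admissibility of `A`
  have hA_meas : ∀ i j, Measurable fun z => A z i j := by
    intro i j
    induction i using Fin.lastCases with
    | last =>
      induction j using Fin.lastCases with
      | last => simp only [hA_ll]; exact measurable_const
      | cast j => simp only [hA_lc]; exact measurable_const
    | cast i =>
      induction j using Fin.lastCases with
      | last => simp only [hA_cl]; exact measurable_const
      | cast j => simp only [hA_cc]; exact (hmeas i j).comp π.continuous.measurable
  have hA_symm : ∀ z, (A z).IsSymm := by
    intro z
    refine Matrix.IsSymm.ext fun i j => ?_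
    induction i using Fin.lastCases with
    | last =>
      induction j using Fin.lastCases with
      | last => rfl
      | cast j => rw [hA_lc, hA_cl]
    | cast i =>
      induction j using Fin.lastCases with
      | last => rw [hA_lc, hA_cl]
      | cast j => rw [hA_cc, hA_cc]; exact (hsymm (π z)).apply i j
  have hquad : ∀ z (ξ : Fin (n + 1) → ℝ), ξ ⬝ᵥ (A z *ᵥ ξ) =
      (fun i : Fin n => ξ (Fin.castSucc i)) ⬝ᵥ (a (π z) *ᵥ fun i : Fin n => ξ (Fin.castSucc i)) +
        ξ (Fin.last n) ^ 2 := by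
    intro z ξ
    simp only [dotProduct, Matrix.mulVec, Fin.sum_univ_castSucc, hA_cc, hA_cl, hA_lc, hA_ll, zero_mul,
      add_zero, zero_add, one_mul, Finset.sum_const_zero]
    ring
  have hsq : ∀ ξ : Fin (n + 1) → ℝ, ξ ⬝ᵥ ξ =
      (fun i : Fin n => ξ (Fin.castSucc i)) ⬝ᵥ (fun i : Fin n => ξ (Fin.castSucc i)) + ξ (Fin.last n) ^ 2 := by
    intro ξ
    simp only [dotProduct, Fin.sum_univ_castSucc]
    ring
  have hA_ell : ∀ z (ξ : Fin (n + 1) → ℝ), min lam 1 * (ξ ⬝ᵥ ξ) ≤ ξ ⬝ᵥ (A z *ᵥ ξ) := by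
    intro z ξ
    rw [hquad, hsq]
    set ξh : Fin n → ℝ := fun i => ξ (Fin.castSucc i)
    have h1 := hell (π z) ξh
    have h0 : 0 ≤ ξh ⬝ᵥ ξh := by
      simp only [dotProduct]; exact Finset.sum_nonneg fun i _ => mul_self_nonneg _
    have h2 : min lam 1 * (ξh ⬝ᵥ ξh) ≤ lam * (ξh ⬝ᵥ ξh) := mul_le_mul_of_nonneg_right (min_le_left _ _) h0
    have h3 : min lam 1 * ξ (Fin.last n) ^ 2 ≤ ξ (Fin.last n) ^ 2 := by
      have := mul_le_mul_of_nonneg_right (min_le_right lam 1) (sq_nonneg (ξ (Fin.last n)))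
      linarith
    nlinarith
  have hA_bd : ∀ z i j, |A z i j| ≤ max Λ 1 := by
    intro z i j
    induction i using Fin.lastCases with
    | last =>
      induction j using Fin.lastCases with
      | last => rw [hA_ll]; simp
      | cast j => rw [hA_lc]; simp
    | cast i =>
      induction j using Fin.lastCases with
      | last => rw [hA_cl]; simp
      | cast j => rw [hA_cc]; exact (hbd _ i j).trans (le_max_left _ _)
  have hUbdd : ∃ K : ℝ, ∀ z, |U z| ≤ K := by
    obtain ⟨K, hK⟩ := hbdd; exact ⟨K, fun z => hK _⟩
  /- the measure-preserving identification `ℝⁿ⁺¹ ≃ ℝ × ℝⁿ`, `z ↦ (z_last, π z)` -/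
  let Φ : EuclideanSpace ℝ (Fin (n + 1)) ≃ᵐ ℝ × EuclideanSpace ℝ (Fin n) :=
    ((MeasurableEquiv.toLp 2 (Fin (n + 1) → ℝ)).symm.trans
      (MeasurableEquiv.piFinSuccAbove (fun _ : Fin (n + 1) => ℝ) (Fin.last n))).trans
      (MeasurableEquiv.prodCongr (MeasurableEquiv.refl ℝ) (MeasurableEquiv.toLp 2 (Fin n → ℝ)))
  have hΦ : MeasurePreserving Φ volume volume := by
    have h1 := PiLp.volume_preserving_ofLp (Fin (n + 1))
    have h2 := volume_preserving_piFinSuccAbove (fun _ : Fin (n + 1) => ℝ) (Fin.last n)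
    have h3 : MeasurePreserving (Prod.map id (WithLp.toLp 2 : (Fin n → ℝ) → EuclideanSpace ℝ (Fin n)))
        (volume : Measure (ℝ × (Fin n → ℝ))) (volume : Measure (ℝ × EuclideanSpace ℝ (Fin n))) := by
      rw [Measure.volume_eq_prod ℝ (Fin n → ℝ), Measure.volume_eq_prod ℝ (EuclideanSpace ℝ (Fin n))]
      exact (MeasurePreserving.id volume).prod (PiLp.volume_preserving_toLp (Fin n))
    exact (h3.comp h2).comp h1
  have hΦ_apply : ∀ t x, Φ (emb t x) = (t, x) := by
    intro t x
    refine Prod.ext ?_ ?_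
    · show (emb t x) (Fin.last n) = t
      exact hemb_last t x
    · show (WithLp.toLp 2 fun j : Fin n => (emb t x) ((Fin.last n).succAbove j)) = x
      ext j
      simp [Fin.succAbove_last, hemb_cast]
  have hΦsymm_apply : ∀ t x, Φ.symm (t, x) = emb t x := fun t x =>
    Φ.injective (by rw [Φ.apply_symm_apply, hΦ_apply])
  have hΦs : MeasurePreserving Φ.symm volume volume := hΦ.symm
  -- the weak formulation for `U`
  have hUweak : ∀ η : EuclideanSpace ℝ (Fin (n + 1)) → ℝ, ContDiff ℝ 1 η → HasCompactSupport η →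
      ∫ y, ∑ i, ∑ j, A y i j * fderiv ℝ U y (EuclideanSpace.single i 1) *
        fderiv ℝ η y (EuclideanSpace.single j 1) = 0 := by
    intro η hη hηc
    set F : EuclideanSpace ℝ (Fin (n + 1)) → ℝ := fun y => ∑ i, ∑ j, A y i j *
      fderiv ℝ U y (EuclideanSpace.single i 1) * fderiv ℝ η y (EuclideanSpace.single j 1) with hFdef
    -- pointwise reduction of the integrand
    have hF : ∀ z, F z = ∑ i : Fin n, ∑ j : Fin n, a (π z) i j * fderiv ℝ u (π z) (EuclideanSpace.single i 1) *
        fderiv ℝ η z (EuclideanSpace.single (Fin.castSucc j) 1) := by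
      intro z
      simp only [hFdef, Fin.sum_univ_castSucc, hA_cc, hA_cl, hA_lc, hA_ll, hdU, hπ_single, hπ_eL, map_zero]
      simp
    -- integrability of the integrand (bounded measurable × continuous compactly supported)
    have hFint : Integrable F := by
      have : F = fun y => ∑ i, ∑ j, A y i j *
          fderiv ℝ U y (EuclideanSpace.single i 1) * fderiv ℝ η y (EuclideanSpace.single j 1) := rfl
      rw [this]
      refine integrable_finsetSum _ fun i _ => integrable_finsetSum _ fun j _ => ?_
      have hM : max Λ 1 ≥ 0 := le_max_of_le_right zero_le_one
      exact integrable_mul_of_le_continuous (n := n + 1)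
        (m := fun y => A y i j * fderiv ℝ U y (EuclideanSpace.single i 1))
        (M := fun y => max Λ 1 * |fderiv ℝ U y (EuclideanSpace.single i 1)|)
        (φ := fun y => fderiv ℝ η y (EuclideanSpace.single j 1))
        ((hA_meas i j).mul (continuous_fderiv_single hU i).measurable)
        (continuous_const.mul (continuous_fderiv_single hU i).abs)
        (fun y => by rw [abs_mul]; exact mul_le_mul_of_nonneg_right (hA_bd y i j) (abs_nonneg _))
        (continuous_fderiv_single hη j) (hηc.fderiv_apply (𝕜 := ℝ) _)
    -- the slices `η(·, t)` are admissible test functions in dimension `n`, so the inner integrals vanish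
    have hinner : ∀ t : ℝ, ∫ x, F (emb t x) = 0 := by
      intro t
      set ηt : EuclideanSpace ℝ (Fin n) → ℝ := fun x => η (emb t x) with hηt_def
      have hemb_diff : ∀ x, HasFDerivAt (fun x => emb t x) ι x := fun x => by
        simpa [emb] using (ι.hasFDerivAt (x := x)).add_const (t • eL)
      have hηt : ContDiff ℝ 1 ηt := hη.comp (ι.contDiff.add contDiff_const)
      have hηtc : HasCompactSupport ηt := by
        refine HasCompactSupport.intro (hηc.isCompact.image π.continuous) fun x hx => ?_
        by_contra hne
        exact hx ⟨emb t x, subset_tsupport _ hne, hπ_emb t x⟩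
      have hdηt : ∀ x (j : Fin n), fderiv ℝ ηt x (EuclideanSpace.single j 1) =
          fderiv ℝ η (emb t x) (EuclideanSpace.single (Fin.castSucc j) 1) := by
        intro x j
        have h := ((hη.differentiable one_ne_zero) _).hasFDerivAt.comp x (hemb_diff x)
        rw [show ηt = η ∘ fun x => emb t x from rfl, h.fderiv, ContinuousLinearMap.comp_apply, hι_single]
      have hpt : (fun x => F (emb t x)) = fun x => ∑ i, ∑ j, a x i j *
          fderiv ℝ u x (EuclideanSpace.single i 1) * fderiv ℝ ηt x (EuclideanSpace.single j 1) := by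
        funext x
        rw [hF, hπ_emb]
        simp only [hdηt]
      rw [hpt]
      exact hweak ηt hηt hηtc
    -- Fubini
    have hInt' : Integrable (fun p : ℝ × EuclideanSpace ℝ (Fin n) => F (Φ.symm p)) (volume.prod volume) :=
      (hΦs.integrable_comp_emb Φ.symm.measurableEmbedding).2 hFint
    calc ∫ z, F z = ∫ p, F (Φ.symm p) := (hΦs.integral_comp' F).symm
      _ = ∫ t, ∫ x, F (Φ.symm (t, x)) := by rw [Measure.volume_eq_prod, integral_prod _ hInt']
      _ = ∫ t : ℝ, (0 : ℝ) := by
          congr 1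
          funext t
          simp_rw [hΦsymm_apply]
          exact hinner t
      _ = 0 := by simp
  -- conclude in dimension `n + 1`
  have hconst := H A (min lam 1) (max Λ 1) (lt_min hlam zero_lt_one) hA_meas hA_symm hA_ell hA_bd U hU hUbdd hUweak
  intro x y
  have hx : u x = U (emb 0 x) := by simp only [U, hπ_emb]
  have hy : u y = U (emb 0 y) := by simp only [U, hπ_emb]
  rw [hx, hy]
  exact hconst _ _


/-! ### Assembly: unit-ball Harnack in dimensions `≥ 3` ⇒ the named fact -/

/-- **Reduction of `divFormLiouville` to Moser's Harnack inequality on the unit ball in dimensions `n ≥ 3`.**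
If for every `n ≥ 3` and every `0 < λ`, `Λ` there is a constant `C` such that `u(x) ≤ C·u(y)` for all
`x, y ∈ B(0,1)`, every admissible coefficient field `a` on `ℝⁿ` (measurable, symmetric, `λ|ξ|² ≤ ξ·aξ`, `|aᵢⱼ| ≤ Λ`)
and every entire `C¹` weak solution `u ≥ 1` of `div(a∇u) = 0`, then the named fact
`Literature.Analysis.PDE.divFormLiouville` holds (in every dimension: `n ≥ 3` by `liouville_of_unitHarnack`, the
dimensions `n ≤ 2` by descending with `liouville_lift`). -/
theorem divFormLiouville_of_unitHarnack_three_le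
    (H : ∀ n : ℕ, 3 ≤ n → ∀ lam Λ : ℝ, 0 < lam → ∃ C : ℝ,
      ∀ (a : EuclideanSpace ℝ (Fin n) → Matrix (Fin n) (Fin n) ℝ),
        (∀ i j, Measurable fun y => a y i j) → (∀ y, (a y).IsSymm) →
        (∀ y (ξ : Fin n → ℝ), lam * (ξ ⬝ᵥ ξ) ≤ ξ ⬝ᵥ (a y *ᵥ ξ)) → (∀ y i j, |a y i j| ≤ Λ) →
        ∀ (u : EuclideanSpace ℝ (Fin n) → ℝ), ContDiff ℝ 1 u → (∀ y, 1 ≤ u y) →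
          (∀ η : EuclideanSpace ℝ (Fin n) → ℝ, ContDiff ℝ 1 η → HasCompactSupport η →
            ∫ y, ∑ i, ∑ j, a y i j * fderiv ℝ u y (EuclideanSpace.single i 1) *
              fderiv ℝ η y (EuclideanSpace.single j 1) = 0) →
          ∀ x ∈ ball (0 : EuclideanSpace ℝ (Fin n)) 1, ∀ y ∈ ball (0 : EuclideanSpace ℝ (Fin n)) 1,
            u x ≤ C * u y) :
    Literature.Analysis.PDE.divFormLiouville := by
  -- descending induction on the codimension `d` from the dimensions `≥ 3`
  suffices key : ∀ d n : ℕ, 3 ≤ n + d →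
      ∀ (a : EuclideanSpace ℝ (Fin n) → Matrix (Fin n) (Fin n) ℝ) (lam Λ : ℝ), 0 < lam →
        (∀ i j, Measurable fun y => a y i j) → (∀ y, (a y).IsSymm) →
        (∀ y (ξ : Fin n → ℝ), lam * (ξ ⬝ᵥ ξ) ≤ ξ ⬝ᵥ (a y *ᵥ ξ)) → (∀ y i j, |a y i j| ≤ Λ) →
        ∀ (u : EuclideanSpace ℝ (Fin n) → ℝ), ContDiff ℝ 1 u → (∃ K : ℝ, ∀ y, |u y| ≤ K) →
          (∀ η : EuclideanSpace ℝ (Fin n) → ℝ, ContDiff ℝ 1 η → HasCompactSupport η →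
            ∫ y, ∑ i, ∑ j, a y i j * fderiv ℝ u y (EuclideanSpace.single i 1) *
              fderiv ℝ η y (EuclideanSpace.single j 1) = 0) →
          ∀ x y, u x = u y by
    intro n
    exact key 3 n (by omega)
  intro d
  induction d with
  | zero =>
    intro n hn a lam Λ hlam hmeas hsymm hell hbd u hu hbdd hweak
    exact liouville_of_unitHarnack (H n (by omega) lam Λ hlam) hmeas hsymm hell hbd hu hbdd hweak
  | succ d ih =>
    intro n hn a lam Λ hlam hmeas hsymm hell hbd u hu hbdd hweak
    exact liouville_lift (ih (n + 1) (by omega)) hlam hmeas hsymm hell hbd hu hbdd hweak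

end Summit.NavierStokesRegularity.NavierStokesRegularity.Theorems.PoloidalWindowDoorPoloidalWindowRigidityDivFormLift

end
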